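import Mathlib.Analysis.SpecificLimits.Basic
import Literature.Computability.AlgebraicComplexity.StrassenPreorder
import HarnessLib

/-!
# The asymptotic preorder of a Strassen preorder (Zuiddam 2018, §2.4; Strassen 1988, §2) — proved

Topic `Literature/Computability/AlgebraicComplexity`; second file of the abstract theory of asymptotic
spectra (see `StrassenPreorder.lean`). Everything here is proved.

## Content

* Subexponential sequences (`IsSubexponential`, defined in `StrassenPreorder.lean`) are closed under
  products, running maxima and domination and contain the affine sequences `c + N k` (Bernoulli);
  the key analytic fact `IsSubexponential.le_of_pow_le`: `a^N ≤ f(N) b^N (∀ N ≥ 1) ⇒ a ≤ b`.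
* `IsStrassenPreorder.asympLe` — **Zuiddam Lemma 2.3**: if `≼` is a Strassen preorder then so is `≼~`
  (additivity by the binomial theorem with a nondecreasing subexponential factor).
* Cancellation (the parts of **Zuiddam Lemma 2.4** that are needed, with (iv) in the sharper
  "telescoping" form that avoids Lemma 2.4(iii)):
  `asympLe_of_forall_natCast_mul_le` — `(∀ n, n a₂ ≼ (n+k) a₁) ⇒ a₂ ≼~ a₁` with factor `1 + N k`
  (proof of 2.4(iv): `a₂^N ≼ a₂^{N-1} a₁ (1+k) ≼ … ≼ (1 + N k) a₁^N`);
  `asympLe_of_add_le` — 2.4(i): `a₂ + b ≼ a₁ + b ⇒ a₂ ≼~ a₁`;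
  `asympLe_of_mul_le` — 2.4(ii): `a₂ b ≼ a₁ b, b ≠ 0 ⇒ a₂ ≼~ a₁` (constant factor).

## References

* J. Zuiddam, PhD thesis (2018), §2.4, Def. 2.1, Lemma 2.3, Lemma 2.4. [Zuiddam2018]
* V. Strassen, J. reine angew. Math. 384 (1988), §2. [Strassen1988]

## Mathlib

`add_pow` (binomial theorem in commutative semirings), `one_add_mul_le_pow` (Bernoulli),
`tendsto_pow_atTop_atTop_of_one_lt`, `Finset.sup`/`Finset.le_sup`.
-/

noncomputable section

open scoped BigOperators
open Filter

namespace Literature.Computability.AlgebraicComplexity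

universe u

variable {S : Type u} [CommSemiring S]

/-! ## Subexponential sequences -/

namespace IsSubexponential

omit [CommSemiring S]

/-- Constants are subexponential. [folklore] -/
theorem const (c : ℕ) : IsSubexponential fun _ => c := by
  intro ε hε
  refine ⟨c, fun N => ?_⟩
  have : (1 : ℝ) ≤ (1 + ε) ^ N := one_le_pow₀ (by linarith)
  nlinarith [Nat.cast_nonneg (α := ℝ) c]

/-- Products of subexponential sequences are subexponential. [folklore] -/
theorem mul {f g : ℕ → ℕ} (hf : IsSubexponential f) (hg : IsSubexponential g) :
    IsSubexponential fun N => f N * g N := by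
  intro ε hε
  -- with `ε' = ε / (2 + ε)` one has `(1 + ε')^2 ≤ 1 + ε`
  set ε' : ℝ := ε / (2 + ε) with hε'
  have hε'0 : 0 < ε' := by positivity
  obtain ⟨C, hC⟩ := hf ε' hε'0
  obtain ⟨D, hD⟩ := hg ε' hε'0
  have hC0 : 0 ≤ C := by
    have := hC 0; simp at this; exact (Nat.cast_nonneg _).trans this
  refine ⟨C * D, fun N => ?_⟩
  have hsq1 : (1 + ε') * (1 + ε') ≤ 1 + ε := by
    have h2 : (0 : ℝ) < 2 + ε := by positivity
    have : 1 + ε' = (2 + 2 * ε) / (2 + ε) := by rw [hε']; field_simp; ring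
    rw [this, div_mul_div_comm, div_le_iff₀ (by positivity)]
    nlinarith [mul_nonneg (mul_nonneg hε.le hε.le) hε.le, sq_nonneg ε]
  have hsq : ((1 + ε') ^ N) * ((1 + ε') ^ N) ≤ (1 + ε) ^ N := by
    rw [← mul_pow]
    exact pow_le_pow_left₀ (by positivity) hsq1 N
  calc ((f N * g N : ℕ) : ℝ) = (f N : ℝ) * (g N : ℝ) := by push_cast; ring
    _ ≤ (C * (1 + ε') ^ N) * (D * (1 + ε') ^ N) :=
        mul_le_mul (hC N) (hD N) (by positivity) (by positivity)
    _ = (C * D) * (((1 + ε') ^ N) * ((1 + ε') ^ N)) := by ring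
    _ ≤ (C * D) * (1 + ε) ^ N := by
        refine mul_le_mul_of_nonneg_left hsq (mul_nonneg hC0 ?_)
        have := hD 0; simp at this; exact (Nat.cast_nonneg _).trans this

/-- A sequence dominated by a subexponential one is subexponential. [folklore] -/
theorem of_le {f g : ℕ → ℕ} (hf : IsSubexponential f) (hgf : ∀ N, g N ≤ f N) :
    IsSubexponential g := by
  intro ε hε
  obtain ⟨C, hC⟩ := hf ε hε
  exact ⟨C, fun N => (Nat.cast_le.2 (hgf N)).trans (hC N)⟩

/-- Affine-linear sequences `N ↦ c + N k` are subexponential (Bernoulli: `1 + N ε ≤ (1+ε)^N`). [folklore] -/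
theorem linear (c k : ℕ) : IsSubexponential fun N => c + N * k := by
  intro ε hε
  refine ⟨c + k / ε, fun N => ?_⟩
  have hB : 1 + (N : ℝ) * ε ≤ (1 + ε) ^ N := one_add_mul_le_pow (by linarith) N
  have h1 : (1 : ℝ) ≤ (1 + ε) ^ N := one_le_pow₀ (by linarith)
  have hk : (N : ℝ) * k ≤ k / ε * (1 + ε) ^ N := by
    have : (N : ℝ) * k = k / ε * (N * ε) := by field_simp
    rw [this]
    exact mul_le_mul_of_nonneg_left (by linarith) (by positivity)
  push_cast
  nlinarith [Nat.cast_nonneg (α := ℝ) c]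

/-- The running maximum `N ↦ max_{j ≤ N} f(j)` of a subexponential sequence is subexponential. [folklore] -/
theorem runningMax {f : ℕ → ℕ} (hf : IsSubexponential f) :
    IsSubexponential fun N => (Finset.range (N + 1)).sup f := by
  intro ε hε
  obtain ⟨C, hC⟩ := hf ε hε
  have hC0 : 0 ≤ C := by
    have := hC 0; simp at this; exact (Nat.cast_nonneg _).trans this
  refine ⟨C, fun N => ?_⟩
  have hsup : (Finset.range (N + 1)).sup f ≤ ⌊C * (1 + ε) ^ N⌋₊ := by
    refine Finset.sup_le fun j hj => ?_
    have hjN : j ≤ N := Nat.lt_succ_iff.1 (Finset.mem_range.1 hj)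
    have : (f j : ℝ) ≤ C * (1 + ε) ^ N :=
      (hC j).trans (mul_le_mul_of_nonneg_left (pow_le_pow_right₀ (by linarith) hjN) hC0)
    exact Nat.le_floor this
  exact (Nat.cast_le.2 hsup).trans (Nat.floor_le (by positivity))

/-- `f(j) ≤ max_{i ≤ N} f(i)` for `j ≤ N`. [folklore] -/
theorem le_runningMax (f : ℕ → ℕ) {j N : ℕ} (hjN : j ≤ N) : f j ≤ (Finset.range (N + 1)).sup f :=
  Finset.le_sup (f := f) (Finset.mem_range.2 (Nat.lt_succ_of_le hjN))

/-- **Key analytic fact**: if `a^N ≤ f(N) b^N` for all `N ≥ 1` with `f` subexponential and `b ≥ 0`,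
then `a ≤ b` (because `(a / ((1+ε) b))^N` would otherwise be unbounded). [folklore] -/
theorem le_of_pow_le {f : ℕ → ℕ} (hf : IsSubexponential f) {a b : ℝ} (hb : 0 ≤ b)
    (H : ∀ N : ℕ, 1 ≤ N → a ^ N ≤ f N * b ^ N) : a ≤ b := by
  by_contra hba
  rw [not_le] at hba
  rcases hb.eq_or_lt with rfl | hb0
  · have := H 1 le_rfl
    simp at this
    linarith
  -- `b > 0`: take `ε` with `(1 + ε) b < a`
  set ε : ℝ := (a / b - 1) / 2 with hε
  have hab : 1 < a / b := (one_lt_div hb0).2 hba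
  have hε0 : 0 < ε := by rw [hε]; linarith
  obtain ⟨C, hC⟩ := hf ε hε0
  set r : ℝ := a / ((1 + ε) * b) with hr
  have hr1 : 1 < r := by
    rw [hr, one_lt_div (by positivity)]
    have : (1 + ε) * b = (a + b) / 2 := by
      rw [hε]; field_simp; ring
    rw [this]; linarith
  have hbound : ∀ N : ℕ, 1 ≤ N → r ^ N ≤ C := by
    intro N hN
    have hpos : (0 : ℝ) < ((1 + ε) * b) ^ N := by positivity
    have h1 : a ^ N ≤ C * ((1 + ε) * b) ^ N := by
      calc a ^ N ≤ f N * b ^ N := H N hN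
        _ ≤ (C * (1 + ε) ^ N) * b ^ N := mul_le_mul_of_nonneg_right (hC N) (by positivity)
        _ = C * ((1 + ε) * b) ^ N := by rw [mul_pow]; ring
    rw [hr, div_pow, div_le_iff₀ hpos]
    exact h1
  obtain ⟨N, hN, hN1⟩ := (((tendsto_pow_atTop_atTop_of_one_lt hr1).eventually_gt_atTop C).and
    (eventually_ge_atTop 1)).exists
  exact absurd (hbound N hN1) (not_le.2 hN)

end IsSubexponential

/-! ## Lemma 2.3: the asymptotic preorder is a Strassen preorder -/

namespace IsStrassenPreorder

variable {le : S → S → Prop}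

/-- `a ≼ b ⇒ a ≼~ b` ("clearly", Zuiddam p. 21). [cite: Zuiddam2018, §2.4] -/
theorem asympLe_of_le (h : IsStrassenPreorder le) {a b : S} (hab : le a b) : AsympLe le a b :=
  ⟨fun _ => 1, IsSubexponential.const 1, fun N => by simpa using h.pow_le_pow hab N⟩

/-- `a ≼~ a`. [cite: Zuiddam2018, Lemma 2.3] -/
theorem asympLe_refl (h : IsStrassenPreorder le) (a : S) : AsympLe le a a :=
  h.asympLe_of_le (h.refl a)

/-- `≼~` is transitive (Zuiddam Lemma 2.3: multiply the two subexponential factors). [cite: Zuiddam2018, Lemma 2.3] -/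
theorem asympLe_trans (h : IsStrassenPreorder le) {a b c : S} (hab : AsympLe le a b)
    (hbc : AsympLe le b c) : AsympLe le a c := by
  obtain ⟨f, hf, hfab⟩ := hab
  obtain ⟨g, hg, hgbc⟩ := hbc
  refine ⟨fun N => f N * g N, hf.mul hg, fun N => ?_⟩
  have h2 : le ((f N : S) * b ^ N) ((f N : S) * ((g N : S) * c ^ N)) := h.mul_left _ (hgbc N)
  have := h.trans (hfab N) h2
  simpa [Nat.cast_mul, mul_assoc] using this

/-- On naturals `n ≼~ m ↔ n ≤ m` (Zuiddam Lemma 2.3, condition (1): `n^N ≤ m^N x_N` forces `n ≤ m`). [cite: Zuiddam2018, Lemma 2.3] -/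
theorem asympLe_natCast_iff (h : IsStrassenPreorder le) {n m : ℕ} :
    AsympLe le (n : S) (m : S) ↔ n ≤ m := by
  refine ⟨fun ⟨f, hf, hle⟩ => ?_, fun hnm => h.asympLe_of_le ((h.natCast_le_iff n m).2 hnm)⟩
  have H : ∀ N : ℕ, (n : ℝ) ^ N ≤ f N * (m : ℝ) ^ N := by
    intro N
    have h1 := hle N
    rw [← Nat.cast_pow, ← Nat.cast_pow, ← Nat.cast_mul, h.natCast_le_iff] at h1
    exact_mod_cast h1
  exact_mod_cast hf.le_of_pow_le (Nat.cast_nonneg m) fun N _ => H N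

/-- `a ≼~ b ⇒ a c ≼~ b c` (Zuiddam Lemma 2.3, condition (2)). [cite: Zuiddam2018, Lemma 2.3] -/
theorem asympLe_mul_right (h : IsStrassenPreorder le) {a b : S} (c : S) (hab : AsympLe le a b) :
    AsympLe le (a * c) (b * c) := by
  obtain ⟨f, hf, hle⟩ := hab
  refine ⟨f, hf, fun N => ?_⟩
  rw [mul_pow, mul_pow, ← mul_assoc]
  exact h.mul_right _ (hle N)

/-- `a ≼~ b ⇒ a + c ≼~ b + c` (Zuiddam Lemma 2.3, condition (2): expand `(a + c)^N` binomially and use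
a nondecreasing subexponential factor). [cite: Zuiddam2018, Lemma 2.3] -/
theorem asympLe_add_right (h : IsStrassenPreorder le) {a b : S} (c : S) (hab : AsympLe le a b) :
    AsympLe le (a + c) (b + c) := by
  obtain ⟨f, hf, hle⟩ := hab
  refine ⟨fun N => (Finset.range (N + 1)).sup f, hf.runningMax, fun N => ?_⟩
  rw [add_pow, add_pow, Finset.mul_sum]
  refine h.sum_le_sum _ fun j hj => ?_
  have hjN : j ≤ N := Nat.lt_succ_iff.1 (Finset.mem_range.1 hj)
  have h1 : le (a ^ j) ((((Finset.range (N + 1)).sup f : ℕ) : S) * b ^ j) :=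
    h.trans (hle j) (h.natCast_mul_le_natCast_mul (IsSubexponential.le_runningMax f hjN) _)
  have h2 := h.mul_right (c ^ (N - j) * (N.choose j : S)) h1
  have e1 : a ^ j * c ^ (N - j) * (N.choose j : S) = a ^ j * (c ^ (N - j) * (N.choose j : S)) := by
    ring
  have e2 : (((Finset.range (N + 1)).sup f : ℕ) : S) * (b ^ j * c ^ (N - j) * (N.choose j : S)) =
      (((Finset.range (N + 1)).sup f : ℕ) : S) * b ^ j * (c ^ (N - j) * (N.choose j : S)) := by
    ring
  rw [e1, e2]
  exact h2

/-- **Zuiddam Lemma 2.3**: the asymptotic preorder of a Strassen preorder is a Strassen preorder.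
[cite: Zuiddam2018, Lemma 2.3] -/
theorem asympLe (h : IsStrassenPreorder le) : IsStrassenPreorder (AsympLe le) where
  refl := h.asympLe_refl
  trans := h.asympLe_trans
  natCast_le_iff _ _ := h.asympLe_natCast_iff
  add_right c hab := h.asympLe_add_right c hab
  mul_right c hab := h.asympLe_mul_right c hab
  exists_le_natCast_mul a _ hb :=
    let ⟨r, hr⟩ := h.exists_le_natCast_mul a hb
    ⟨r, h.asympLe_of_le hr⟩

/-! ## Lemma 2.4: cancellation -/

/-- **Zuiddam Lemma 2.4(iv), telescoping form**: if `n a₂ ≼ (n + k) a₁` for every `n ∈ ℕ` then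
`a₂^N ≼ (1 + N k) a₁^N` for every `N`, hence `a₂ ≼~ a₁`. [cite: Zuiddam2018, Lemma 2.4] -/
theorem asympLe_of_forall_natCast_mul_le (h : IsStrassenPreorder le) {a₂ a₁ : S} (k : ℕ)
    (H : ∀ n : ℕ, le ((n : S) * a₂) (((n + k : ℕ) : S) * a₁)) : AsympLe le a₂ a₁ := by
  refine ⟨fun N => 1 + N * k, IsSubexponential.linear 1 k, fun N => ?_⟩
  induction N with
  | zero => simpa using h.refl 1
  | succ N ih =>
    have step1 : le (a₂ ^ N * a₂) (((1 + N * k : ℕ) : S) * a₁ ^ N * a₂) := h.mul_right a₂ ih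
    have step3 := h.mul_left (a₁ ^ N) (H (1 + N * k))
    rw [pow_succ]
    refine h.trans step1 ?_
    have e1 : ((1 + N * k : ℕ) : S) * a₁ ^ N * a₂ = a₁ ^ N * (((1 + N * k : ℕ) : S) * a₂) := by ring
    have e2 : ((1 + (N + 1) * k : ℕ) : S) * a₁ ^ (N + 1) =
        a₁ ^ N * (((1 + N * k + k : ℕ) : S) * a₁) := by
      push_cast; ring
    rw [e1, e2]
    exact step3

/-- **Zuiddam Lemma 2.4(i)** (additive cancellation): `a₂ + b ≼ a₁ + b ⇒ a₂ ≼~ a₁`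
(`∀ n, n a₂ + b ≼ n a₁ + b` by induction; then `b ≼ k a₁` and the telescoping lemma; if `a₁ = 0`
then `a₂ = 0`). [cite: Zuiddam2018, Lemma 2.4] -/
theorem asympLe_of_add_le (h : IsStrassenPreorder le) {a₂ a₁ b : S} (H : le (a₂ + b) (a₁ + b)) :
    AsympLe le a₂ a₁ := by
  have H1 : ∀ n : ℕ, le ((n : S) * a₂ + b) ((n : S) * a₁ + b) := by
    intro n
    induction n with
    | zero => simpa using h.refl b
    | succ n ih =>
      have s1 : le ((n : S) * a₂ + (a₂ + b)) ((n : S) * a₂ + (a₁ + b)) := h.add_left _ H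
      have s2 : le ((n : S) * a₂ + b + a₁) ((n : S) * a₁ + b + a₁) := h.add_right _ ih
      have e1 : ((n + 1 : ℕ) : S) * a₂ + b = (n : S) * a₂ + (a₂ + b) := by push_cast; ring
      have e2 : (n : S) * a₂ + (a₁ + b) = (n : S) * a₂ + b + a₁ := by ring
      have e3 : ((n + 1 : ℕ) : S) * a₁ + b = (n : S) * a₁ + b + a₁ := by push_cast; ring
      rw [e1, e3]
      exact h.trans s1 (by rw [e2]; exact s2)
  by_cases ha₁ : a₁ = 0
  · subst ha₁
    suffices ha₂ : a₂ = 0 by subst ha₂; exact h.asympLe_refl 0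
    by_contra ha₂
    obtain ⟨r, hr⟩ := h.exists_one_le_natCast_mul ha₂
    obtain ⟨rb, hrb⟩ := h.exists_le_natCast b
    refine h.not_forall_natCast_le ((r : S) * (rb : S)) fun n => ?_
    have s1 : le ((n : S) * 1) ((n : S) * ((r : S) * a₂)) := h.mul_left _ hr
    have s2 : le ((r : S) * ((n : S) * a₂)) ((r : S) * ((n : S) * a₂ + b)) :=
      h.mul_left _ (h.le_add_right _ _)
    have s3 : le ((r : S) * ((n : S) * a₂ + b)) ((r : S) * b) := h.mul_left _ (by simpa using H1 n)
    have s4 : le ((r : S) * b) ((r : S) * (rb : S)) := h.mul_left _ hrb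
    have e1 : (n : S) * ((r : S) * a₂) = (r : S) * ((n : S) * a₂) := by ring
    rw [mul_one, e1] at s1
    exact h.trans s1 (h.trans s2 (h.trans s3 s4))
  · obtain ⟨k, hk⟩ := h.exists_le_natCast_mul b ha₁
    refine h.asympLe_of_forall_natCast_mul_le k fun n => ?_
    have s1 : le ((n : S) * a₂) ((n : S) * a₂ + b) := h.le_add_right _ _
    have s3 : le ((n : S) * a₁ + b) ((n : S) * a₁ + (k : S) * a₁) := h.add_left _ hk
    have e : ((n + k : ℕ) : S) * a₁ = (n : S) * a₁ + (k : S) * a₁ := by push_cast; ring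
    rw [e]
    exact h.trans s1 (h.trans (H1 n) s3)

/-- **Zuiddam Lemma 2.4(ii)** (multiplicative cancellation): `a₂ b ≼ a₁ b` with `b ≠ 0` implies
`a₂ ≼~ a₁`, indeed `a₂^N ≼ (m r) a₁^N` for all `N` where `1 ≼ m b`, `b ≼ r`. [cite: Zuiddam2018, Lemma 2.4] -/
theorem asympLe_of_mul_le (h : IsStrassenPreorder le) {a₂ a₁ b : S} (hb : b ≠ 0)
    (H : le (a₂ * b) (a₁ * b)) : AsympLe le a₂ a₁ := by
  obtain ⟨m, hm⟩ := h.exists_one_le_natCast_mul hb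
  obtain ⟨r, hr⟩ := h.exists_le_natCast b
  refine ⟨fun _ => m * r, IsSubexponential.const _, fun N => ?_⟩
  have HN : le (a₂ ^ N * b) (a₁ ^ N * b) := by
    induction N with
    | zero => simpa using h.refl b
    | succ N ih =>
      have s1 : le (a₂ * (a₂ ^ N * b)) (a₂ * (a₁ ^ N * b)) := h.mul_left _ ih
      have s2 : le (a₁ ^ N * (a₂ * b)) (a₁ ^ N * (a₁ * b)) := h.mul_left _ H
      have e1 : a₂ ^ (N + 1) * b = a₂ * (a₂ ^ N * b) := by ring
      have e2 : a₂ * (a₁ ^ N * b) = a₁ ^ N * (a₂ * b) := by ring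
      have e3 : a₁ ^ (N + 1) * b = a₁ ^ N * (a₁ * b) := by ring
      rw [e1, e3]
      exact h.trans s1 (by rw [e2]; exact s2)
  have s1 : le (a₂ ^ N * 1) (a₂ ^ N * ((m : S) * b)) := h.mul_left _ hm
  have s2 : le ((m : S) * (a₂ ^ N * b)) ((m : S) * (a₁ ^ N * b)) := h.mul_left _ HN
  have s3 : le ((m : S) * (a₁ ^ N * b)) ((m : S) * (a₁ ^ N * (r : S))) :=
    h.mul_left _ (h.mul_left _ hr)
  have e1 : a₂ ^ N * ((m : S) * b) = (m : S) * (a₂ ^ N * b) := by ring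
  have e2 : ((m * r : ℕ) : S) * a₁ ^ N = (m : S) * (a₁ ^ N * (r : S)) := by push_cast; ring
  rw [mul_one, e1] at s1
  rw [e2]
  exact h.trans s1 (h.trans s2 s3)

end IsStrassenPreorder

end Literature.Computability.AlgebraicComplexity

end
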